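import Literature.Claims.NS.ClayVariants
import Literature.Claims.NS.PaiLimsuwan2026
import Literature.Claims.NS.ClayPeriodicStrainSupCriterion
import Literature.Analysis.FunctionSpaces.FlatTorusProofs
import Literature.Analysis.FunctionSpaces.TorusLatticeCells
import Literature.Analysis.FunctionSpaces.TorusGridCellsGeometry
import Literature.Analysis.FluidPDE.ClassicalSolutionGalilean
import Literature.Analysis.FluidPDE.NSLerayHopf
import HarnessLib

/-!
# Claim skeleton C144 — S. Passolungo, «Navier–Stokes Global Regularity via Ledger, Windows,
# Curve-GIL, and a Bubble-Tree Carleson Structure» (Zenodo 17251544, 2025-10-02)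

D-0090 NS-CLAIMS SWEEP, typist = ns-claims-typist-6 g5. TEXT OF RECORD: Zenodo record 17251544
(single version; PDF sha16 e91d53b28d3f1c3d, 10 pp.; pp.1–5 English, pp.6–10 the same text in
Italian; census pin `census/texts/Passolungo2025/`, PDF page = file `pages/pNNN.txt`, no printed page
numbers; LOCATORS.md by ns-claims-lit-3 g7). The file TYPES what is printed; nothing is asserted.
Every `def … : Prop` below is a faithful transcription of a printed sentence with its locator; the
`theorem`s are compositions / unfoldings only.

## What the text is (LOCATORS §4, checked on pp.1–5)
A five-page programme: Abstract §1 and **Main Theorem §2 (p.1 l.15–20)**, a bullet list §3, a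
one-paragraph roadmap §4 (p.2), two figure captions §§5–6, three «Boxes» A/B/C (p.3–4) and seven
numbered paragraphs §§7–13 (p.4–5) of one to three sentences each, an ℝ³ remark §14 and a list of
tool NAMES §15 («Appendices» — no appendix text exists). There is no displayed Navier–Stokes system,
no definition of `S` (read: the strain / deformation tensor, cf. «∂ₜ|ω| ≤ ‖S‖_∞|ω| + νΔ|ω|» p.5 l.6),
and NONE of the symbols of the chain — `Π_{≥j}`, `Π⁺_{≥j}`, `In_{r−1→r}`, `NN_r`, `E_{B_r}`, `K_r`,
`τ_r`, `θ`, `δ(θ)`, `q_{r,θ}`, `q^{(ener)}`, `C_iso`, `σ`, caps/chains, `𝔊_k`, `a_k`, `A_{r,θ}`,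
`J`, `L`, `μ` — is defined anywhere (each appears first inside the sentence that uses it). The typing
therefore follows the C21 pattern (memo (iii), RULINGS v1.35 (2)): the undefined symbols are bundled
as an UNINTERPRETED signature `Gadgets` (real / `ℝ≥0∞`-valued functions with the arities the
displays force), every printed law is a `Step_k (G : Gadgets) … : Prop` quoting its display, the
text's only links between the gadgets and the solution are typed where printed (`E₀` = initial
energy, §7; the layer-cake bound on `‖S(t)‖_∞`, §13), and the chain is exhibited as
`claim_of_steps : GadgetsExist → Step9_Integration → ClaimedTheorem` — the two places where
mathematics would have to happen are (i) `GadgetsExist` («the devices can be extracted from any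
smooth solution and obey Boxes A–C / §§7–12») and (ii) `Step9_Integration` (§13 p.5 l.5 «Integrating
and using μ gives ∫₀ᵀ ‖S‖_∞ dt < ∞», one clause).

## Setting (printed p.1 l.6, l.15–17) in tree vocabulary
Periodic problem à la Fefferman (B): velocity/pressure on `ℝ³`, `ℤ³`-periodic in `x`
(`IsLatticePeriodic`, the «unit torus T³»), classical solutions `IsClassicalNSSolutionOn S ν 0 u p`
(no force is printed), datum `u 0 = u₀` smooth, periodic, MEAN ZERO (p.1 l.16; divergence-free is
not printed — implicit in «incompressible», typed), viscosity `ν > 0` not printed (implicit in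
«Navier–Stokes», `c_ν` p.4 l.11). `S(t,x)` = `PaiLimsuwan2026.strain (u t) x = ½(∇u + ∇uᵀ)`
(reused tree definition), `‖S(t)‖_{L^∞} = ⨆ₓ ‖S(t,x)‖ₑ` (`ℝ≥0∞`, no `sSup` junk), the time integral a
lower Lebesgue integral over `(0,T)`.

## Two readings of «smooth solution … on [0,T]» (p.1 l.16–18) — both typed, the lanes decide
* `ClaimedTheorem` — the A-PRIORI reading (the one the «In particular, no finite-time blow-up»
  clause l.19–20 and the roadmap need): `u` classical on the HALF-OPEN slab `[0,T)`, conclusion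
  `∫₀ᵀ ‖S‖_∞ < ∞`. This is the face on the composition path.
* `ClaimedTheoremClosed` — the LITERAL reading: `u` classical on the CLOSED slab `[0,T]`; then
  `(t,x) ↦ S(t,x)` is continuous on `[0,T] × ℝ³` and `ℤ³`-periodic in `x`, hence bounded, and the
  conclusion holds for every such `u` by compactness (TRUE-type, flagged; not proved here at TYPED).
* `ClaimedRegularity` — «there is no finite-time blow-up; smoothness and uniqueness persist globally»
  (l.19–20) = printed-(B) solvability `clayPeriodic.Solvable ν 0 u₀` for the mean-zero data; the step
  «(via Beale–Kato–Majda)» / «Mini-BKM» p.5 l.6–7 is `Step10_MiniBKM : ClaimedTheorem → ClaimedRegularity`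
  (TRUE-type classically: continuation under `∫‖S‖_∞ < ∞` is the deformation-tensor form of BKM,
  Ponce 1985 / Kozono–Taniuchi 2000, plus periodic local existence; the tree has the periodic
  GRADIENT-sup alternative `clayPeriodic_regularity_iff_aprioriGradientBound`, not the strain form —
  flagged, not discharged). Clay link: `ClayBridge : ClaimedRegularity → clayPeriodic.Regularity`
  needs the Galilean removal of the mean (Δ4; tree `TorusClassicalNSGalileanBoost`) — typed as a
  named bridge, not proved here.

## Step list (print order of the load-bearing sentences; typist flags are reading aids, not verdicts)
* Box A p.3 l.7–13 / §9 p.4 l.13–15 — `Step3_WeakIsotropy` («δ(θ) ≤ C θ^{1+σ}», σ ∈ (0,1/8]) — over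
  undefined `δ`, `θ`: uninterpreted law [suspicious: no definition, «Proof: cone packets + block
  quasi-orthogonality + capacity» is the whole proof].
* Box B p.3 l.14–17 / §11 p.4 l.19–21 — `Step5_CurveGIL` («ess-sup … ‖𝔊_k‖_∞ ≥ c·δ⁻¹») [same].
* Box C p.4 l.1–6 — `Step2b_EnergeticQuantum` («q^{(ener)}_{r,θ} ≥ c_e θ²»), `Step6_StrengthenedQuantum`
  («q_{r,θ} ≥ c_* θ^{1−σ}»), `Step1c_Concurrency` («Σ_Q ∫_Q In ≤ C_loc ∫_I Π⁺ ≤ C_loc E₀») [same].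
* §7 p.4 l.7–9 — `Step1_Capacity` («∫_I Π⁺_{≥j} ≤ E₀ (energy identity)») and `Step1b_Interface`
  («In_{r−1→r} ≤ C_loc Π⁺_{≥j} (paraproducts)») [suspicious: for the POSITIVE PART of a flux the
  energy identity gives no such bound; undefined symbols].
* §8 p.4 l.10–12 — `Step2_BlockEnergy` («d/dt E_{B_r} + c_ν K_r² E_{B_r} ≤ In_{r−1→r} + NN_r»).
* §10 p.4 l.16–18 — `Step4_Chaining` (temporal chaining; no quantitative content — typed as an
  opaque field `chains` of the signature, see `Gadgets`).
* §12 p.4 l.27–p.5 l.2 — `Step7_CarlesonMass` («μ(I) ≤ C·E₀»).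
* §13 p.5 l.4–5 — `Step8_LayerCake` («‖S‖_∞ ≤ C Σ_k 2^{−k/2} a_k; on B_r, Σ_{k∈B_r} 2^{k/2} a_k ≤
  C 2^{(J+rL)/2} Σ_m θ_m 1_{A_{r,θ_m}}») — the only printed link gadget → solution.
* §13 p.5 l.5 — `Step9_Integration` («Integrating and using μ gives ∫₀ᵀ ‖S‖_∞ dt < ∞») — ONE
  CLAUSE; typed as the implication it asserts, over the signature [suspicious: `A_{r,θ}` and `μ` are
  never related in print (μ is a sum over «bubbles β», p.5 l.1), so at the typed grain the
  implication is not a tautology; a charitable reading supplying `∫_I Σ_m θ_m 1_{A_{r,θ_m}} ≤ μ(I)`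
  per block makes the arithmetic close by a geometric series in `r` — recorded, not typed as printed].
* p.5 l.6–7 — `Step10_MiniBKM` (TRUE-type classically, see above).
* `GadgetsExist` — the unprinted existential: for every smooth periodic solution there ARE gadgets
  obeying Steps 1–8 («extracted from u by fixed thresholds, dyadic blocks and cap decompositions»,
  p.4 l.25–26) [the typist's reading of where the text's mathematics would live; flagged as the
  natural unfilled-gap face — the lanes decide].

## References
* [Passolungo2025] S. Passolungo, Zenodo 17251544 (2025), 10 pp.
* [FeffermanClay2006] C. L. Fefferman, CMI problem description, (B) with (8)–(11).
* [BealeKatoMajda1984] Beale–Kato–Majda, Comm. Math. Phys. 94 (1984), Thm 1.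

WHAT THIS IS NOT: not a claim about NS regularity or blow-up; not a claim about any author beyond
the typed locator.
-/

open scoped ContDiff ENNReal Topology
open Set MeasureTheory Filter

namespace Literature.Claims.NS.Passolungo2025

open Literature.Analysis Literature.Analysis.FluidPDE Literature.Claims.NS.ClayVariants
open Literature.Claims.NS.PaiLimsuwan2026 (E3 strain)
open Literature.Analysis.FunctionSpaces (Torus.repr Torus.proj Torus.lift_descend_holds Torus.lift_apply Torus.descend_apply Torus.repr_apply_mem_Ico)

noncomputable section

/-! ## Setting -/

/-- The period cell `[0,1)³` of `𝕋³ = ℝ³/ℤ³` (the domain of «mean zero», p.1 l.16; Fefferman (8)).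
[cite: Passolungo2025, §2 p.1 l.16] -/
def cell : Set E3 := {x | ∀ i : Fin 3, x i ∈ Ico (0 : ℝ) 1}

/-- «u₀ … have mean zero» (p.1 l.16): `∫_{[0,1)³} u₀ = 0` (Bochner; junk-free for the continuous
periodic data used here). [cite: Passolungo2025, §2 p.1 l.16] -/
def IsMeanZero (v : E3 → E3) : Prop := ∫ x in cell, v x = 0

/-- ADMISSIBLE DATUM (p.1 l.16 «Let u₀ ∈ C^∞(T³) have mean zero»): smooth, `ℤ³`-periodic, mean
zero, and divergence-free (not printed; implicit in «incompressible Navier–Stokes», typed).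
[cite: Passolungo2025, §2 p.1 l.16] -/
structure IsDatum (u₀ : E3 → E3) : Prop where
  smooth : ContDiff ℝ ∞ u₀
  periodic : IsLatticePeriodic u₀
  meanZero : IsMeanZero u₀
  divFree : NSWave0.IsDivFree u₀

/-- «Let u be the corresponding smooth solution to incompressible Navier–Stokes» on the time set
`T` (p.1 l.16–17): a classical unforced solution (`IsClassicalNSSolutionOn`, tree) with `u 0 = u₀`
and `u(·,t)` `ℤ³`-periodic (Fefferman (10); the pressure is not constrained in print).
[cite: Passolungo2025, §2 p.1 l.16–17] [cite: FeffermanClay2006, (10) p.2] -/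
structure IsSmoothSolutionOn (T : Set ℝ) (ν : ℝ) (u₀ : E3 → E3) (u : ℝ → E3 → E3)
    (p : ℝ → E3 → ℝ) : Prop where
  solves : IsClassicalNSSolutionOn T ν 0 u p
  initial : u 0 = u₀
  periodic : ∀ t ∈ T, IsLatticePeriodic (u t)

/-- `∫₀ᵀ ‖S(t)‖_{L^∞} dt` (p.1 l.18), `S = ½(∇u + ∇uᵀ)` the strain (tree `PaiLimsuwan2026.strain`,
operator norm), as a lower Lebesgue integral of the `ℝ≥0∞`-valued sup over `(0,T)` — no `sSup`
junk, no integrability side condition. [cite: Passolungo2025, §2 p.1 l.18] -/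
def strainSupIntegral (T : ℝ) (u : ℝ → E3 → E3) : ℝ≥0∞ :=
  ∫⁻ t in Ioo 0 T, ⨆ x : E3, ‖strain (u t) x‖ₑ

/-! ## The claimed statements (§2 Main Theorem, p.1 l.15–20) -/

/-- **MAIN THEOREM (T³), a-priori reading — ON THE COMPOSITION PATH** (p.1 l.15–18 with l.19–20):
«Let u₀ ∈ C^∞(T³) have mean zero. Let u be the corresponding smooth solution to incompressible
Navier–Stokes on [0,T]. Then ∫₀ᵀ ‖S(t)‖_{L^∞} dt < ∞ for every finite T > 0», read as an a-priori
bound for the classical solution on the half-open slab `[0,T)` (the reading under which «In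
particular, there is no finite-time blow-up» is an inference). `ν > 0` implicit.
[cite: Passolungo2025, §2 p.1 l.15–20] [claim: Passolungo2025, status: under-review] -/
def ClaimedTheorem : Prop :=
  ∀ ν : ℝ, 0 < ν → ∀ u₀ : E3 → E3, IsDatum u₀ → ∀ T : ℝ, 0 < T →
    ∀ (u : ℝ → E3 → E3) (p : ℝ → E3 → ℝ), IsSmoothSolutionOn (Ico 0 T) ν u₀ u p →
      strainSupIntegral T u < ⊤

/-- **MAIN THEOREM (T³), literal reading** (p.1 l.15–18 verbatim: «smooth solution … on [0,T]»,
CLOSED slab): for `u` classical on `[0,T] × ℝ³` and periodic, `∫₀ᵀ ‖S‖_∞ < ∞`. TRUE-type by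
compactness (continuity of `∇u` on `[0,T] × ℝ³` + periodicity); typed so the lanes can key the
literal sentence; not on the composition path. [cite: Passolungo2025, §2 p.1 l.15–18] [claim: Passolungo2025, status: under-review] -/
def ClaimedTheoremClosed : Prop :=
  ∀ ν : ℝ, 0 < ν → ∀ u₀ : E3 → E3, IsDatum u₀ → ∀ T : ℝ, 0 < T →
    ∀ (u : ℝ → E3 → E3) (p : ℝ → E3 → ℝ), IsSmoothSolutionOn (Icc 0 T) ν u₀ u p →
      strainSupIntegral T u < ⊤

/-- **«In particular, there is no finite-time blow-up; smoothness and uniqueness persist globally»**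
(p.1 l.19–20), existence half, in Fefferman's printed periodic class (10): every admissible (mean
zero) datum has a global smooth periodic solution, `clayPeriodic.Solvable ν 0 u₀`. (Uniqueness is
classical for smooth periodic solutions and not typed separately.) [cite: Passolungo2025, §2 p.1 l.19–20] [cite: FeffermanClay2006, (B) with (8) (10) (11) p.2] [claim: Passolungo2025, status: under-review] -/
def ClaimedRegularity : Prop :=
  ∀ ν : ℝ, 0 < ν → ∀ u₀ : E3 → E3, IsDatum u₀ → clayPeriodic.Solvable ν 0 u₀

/-- **Clay link** — `ClaimedRegularity` covers MEAN-ZERO periodic data only (Δ4); Clay (B)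
(`clayPeriodic.Regularity`) asks all smooth divergence-free periodic data. The bridge is the
Galilean removal of the mean (classical; tree `TorusClassicalNSGalileanBoost`), typed as a named
implication and NOT proved in this file. [cite: Passolungo2025, §2 p.1 l.15–20] [cite: FeffermanClay2006, (B) p.2] -/
def ClayBridge : Prop := ClaimedRegularity → clayPeriodic.Regularity

/-! ## The uninterpreted signature of the chain (symbols used but never defined in the text) -/

/-- The symbols of §§7–13 / Boxes A–C, with the arities their displays force and NO meaning
(none is defined in the 10 pp.; LOCATORS §4): `E₀` «initial energy budget» (p.2 l.2, p.4 l.8);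
`fluxPlus j t` = «Π⁺_{≥j}(t)» (p.4 l.8); `influx r t` = «In_{r−1→r}» (p.4 l.9); `NN r t` (p.4 l.11);
`EB r t` = «E_{B_r}» and `K r` = «K_r» (p.4 l.11); `cν`, `Cloc`, `ce`, `cstar`, `Cwi`, `cgil`, `Cμ`,
`Clc` the printed constants; `σ` (Box A); `δ θ` = «δ(θ)» (Box A); `qener r θ`, `q r θ` (Box C);
`gil θ` = the «ess-sup … ‖𝔊_k‖_{L^∞}» of Box B at level θ; `a k t` = «a_k» (p.5 l.4); `J`, `L`
(p.5 l.4, blocks `B_r = [J+rL, J+(r+1)L)` — the typist's reading of «on B_r», flagged); `θlev m` =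
«θ_m» and `A r m` = «A_{r,θ_m}» ⊆ ℝ (time sets, p.5 l.4–5); `μ I` = «Carleson mass μ(I)» (p.5 l.1).
Magnitudes that are only summed/integrated are `ℝ≥0∞`-valued (junk-free sums).
[cite: Passolungo2025, §§7–13 p.4–5; Boxes A–C p.3–4] -/
structure Gadgets where
  E₀ : ℝ≥0∞
  fluxPlus : ℕ → ℝ → ℝ≥0∞
  influx : ℕ → ℝ → ℝ≥0∞
  NN : ℕ → ℝ → ℝ
  EB : ℕ → ℝ → ℝ
  K : ℕ → ℝ
  cν : ℝ
  Cloc : ℝ≥0∞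
  ce : ℝ
  cstar : ℝ
  Cwi : ℝ
  cgil : ℝ
  σ : ℝ
  δ : ℝ → ℝ
  qener : ℕ → ℝ → ℝ
  q : ℕ → ℝ → ℝ
  gil : ℝ → ℝ
  a : ℕ → ℝ → ℝ≥0∞
  J : ℕ
  L : ℕ
  θlev : ℕ → ℝ≥0∞
  A : ℕ → ℕ → Set ℝ
  μ : Set ℝ → ℝ≥0∞
  Cμ : ℝ≥0∞
  Clc : ℝ≥0∞

/-! ## Steps (printed laws over the signature) -/

/-- **§7 «Capacity»** (p.4 l.8): «∫_I Π⁺_{≥j} ≤ E₀ (energy identity)», for every time interval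
`I = [a,b] ⊆ [0,T]` and every `j`. [cite: Passolungo2025, §7 p.4 l.8] [claim: Passolungo2025, status: under-review] -/
def Step1_Capacity (G : Gadgets) (T : ℝ) : Prop :=
  ∀ j : ℕ, ∀ a b : ℝ, 0 ≤ a → a ≤ b → b ≤ T → (∫⁻ t in Icc a b, G.fluxPlus j t) ≤ G.E₀

/-- **§7 «Interface domination»** (p.4 l.8–9): «In_{r−1→r} ≤ C_loc Π⁺_{≥j} (paraproducts)» (the
relation between `r` and `j` is not printed: typed for all pairs). [cite: Passolungo2025, §7 p.4 l.8–9] [claim: Passolungo2025, status: under-review] -/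
def Step1b_Interface (G : Gadgets) : Prop :=
  ∀ r j : ℕ, ∀ t : ℝ, G.influx r t ≤ G.Cloc * G.fluxPlus j t

/-- **Box C «Concurrency»** (p.4 l.5–6): «Σ_{Q⊂I} ∫_Q In_{r−1→r} ≤ C_loc ∫_I Π⁺_{≥j} ≤ C_loc E₀»,
typed at the grain of its two outer members for `I = [a,b] ⊆ [0,T]`. [cite: Passolungo2025, Box C p.4 l.5–6] [claim: Passolungo2025, status: under-review] -/
def Step1c_Concurrency (G : Gadgets) (T : ℝ) : Prop :=
  ∀ r : ℕ, ∀ a b : ℝ, 0 ≤ a → a ≤ b → b ≤ T → (∫⁻ t in Icc a b, G.influx r t) ≤ G.Cloc * G.E₀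

/-- **§8 «Block energy inequality»** (p.4 l.11): «d/dt E_{B_r} + c_ν K_r² E_{B_r} ≤ In_{r−1→r} + NN_r».
[cite: Passolungo2025, §8 p.4 l.10–11] [claim: Passolungo2025, status: under-review] -/
def Step2_BlockEnergy (G : Gadgets) : Prop :=
  ∀ r : ℕ, ∀ t : ℝ,
    deriv (G.EB r) t + G.cν * G.K r ^ 2 * G.EB r t ≤ (G.influx r t).toReal + G.NN r t

/-- **§8 / Box C «Energetic quantum»** (p.4 l.2–3, l.12): «q^{(ener)}_{r,θ} ≥ c_e θ²».
[cite: Passolungo2025, Box C p.4 l.2–3; §8 p.4 l.12] [claim: Passolungo2025, status: under-review] -/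
def Step2b_EnergeticQuantum (G : Gadgets) : Prop :=
  ∀ r : ℕ, ∀ θ : ℝ, 0 < θ → G.ce * θ ^ 2 ≤ G.qener r θ

/-- **Box A «WI_σ (θ–δ linkage)»** (p.3 l.7–13; §9 p.4 l.13–15): «There exist σ ∈ (0,1/8], C_iso
such that … Consequently, δ(θ) ≤ C·θ^{1+σ}», typed at the grain of its consequence.
[cite: Passolungo2025, Box A p.3 l.8–12; §9 p.4 l.13–15] [claim: Passolungo2025, status: under-review] -/
def Step3_WeakIsotropy (G : Gadgets) : Prop :=
  0 < G.σ ∧ G.σ ≤ 1 / 8 ∧ ∀ θ : ℝ, 0 < θ → G.δ θ ≤ G.Cwi * θ ^ (1 + G.σ)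

/-- **Box B «Curve-GIL»** (p.3 l.14–17; §11 p.4 l.19–21): in an active window at level `θ` with a
`δ`-cap chain, «ess-sup_{t∈T'_Q} sup_{k∈B_r} ‖𝔊_k(·,t)‖_{L^∞_x} ≥ c·δ⁻¹», typed at the grain
`gil θ ≥ c / δ(θ)`. [cite: Passolungo2025, Box B p.3 l.15–17; §11 p.4 l.19–21] [claim: Passolungo2025, status: under-review] -/
def Step5_CurveGIL (G : Gadgets) : Prop :=
  ∀ θ : ℝ, 0 < θ → G.cgil / G.δ θ ≤ G.gil θ

/-- **Box C «Strengthened per-window quantum»** (p.4 l.4; p.1 l.13, l.26): «δ(θ) ≤ Cθ^{1+σ} ⇒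
q_{r,θ} ≥ c_* θ^{1−σ}», typed at the grain of its consequence. [cite: Passolungo2025, Box C p.4 l.4] [claim: Passolungo2025, status: under-review] -/
def Step6_StrengthenedQuantum (G : Gadgets) : Prop :=
  ∀ r : ℕ, ∀ θ : ℝ, 0 < θ → G.cstar * θ ^ (1 - G.σ) ≤ G.q r θ

/-- **§12 «Bubble-tree + Carleson packing»** (p.4 l.27–p.5 l.2; Fig. 2 p.3 l.5): «Define the
Carleson mass μ(I) := Σ_{β : Q_β ⊂ I} θ_β·|T'_{Q,β}|. By strengthened quantum … and concurrency,
μ(I) ≤ C·E₀», for every interval `I = [a,b] ⊆ [0,T]`. [cite: Passolungo2025, §12 p.5 l.1–2] [claim: Passolungo2025, status: under-review] -/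
def Step7_CarlesonMass (G : Gadgets) (T : ℝ) : Prop :=
  ∀ a b : ℝ, 0 ≤ a → a ≤ b → b ≤ T → G.μ (Icc a b) ≤ G.Cμ * G.E₀

/-- **§13 «Layer-cake»** (p.5 l.4–5): «‖S‖_∞ ≤ C Σ_k 2^{−k/2} a_k; on B_r, Σ_{k∈B_r} 2^{k/2} a_k ≤
C 2^{(J+rL)/2} Σ_m θ_m 1_{A_{r,θ_m}}» — the only printed link from the signature to the solution
`u` (its strain sup at time `t`), with `B_r = [J+rL, J+(r+1)L)` (typist's reading of «on B_r»).
[cite: Passolungo2025, §13 p.5 l.4–5] [claim: Passolungo2025, status: under-review] -/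
def Step8_LayerCake (G : Gadgets) (T : ℝ) (u : ℝ → E3 → E3) : Prop :=
  (∀ t ∈ Ico 0 T, (⨆ x : E3, ‖strain (u t) x‖ₑ) ≤
      G.Clc * ∑' k : ℕ, (2 : ℝ≥0∞) ^ (-((k : ℝ) / 2)) * G.a k t) ∧
  (∀ r : ℕ, ∀ t ∈ Ico 0 T,
      (∑ k ∈ Finset.Ico (G.J + r * G.L) (G.J + (r + 1) * G.L), (2 : ℝ≥0∞) ^ ((k : ℝ) / 2) * G.a k t) ≤
        G.Clc * (2 : ℝ≥0∞) ^ (((G.J : ℝ) + r * G.L) / 2) *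
          ∑' m : ℕ, G.θlev m * (G.A r m).indicator 1 t)

/-- **§13, the closing inference** (p.5 l.5): «Integrating and using μ gives ∫₀ᵀ ‖S‖_∞ dt < ∞» —
one clause, typed as the implication it asserts over the signature: Carleson mass bound ∧
layer-cake ⇒ the main integral bound. (`A_{r,θ}` and `μ` are not related anywhere in print.)
[cite: Passolungo2025, §13 p.5 l.5] [claim: Passolungo2025, status: under-review] -/
def Step9_Integration : Prop :=
  ∀ (G : Gadgets) (T : ℝ) (u : ℝ → E3 → E3), 0 < T →
    Step7_CarlesonMass G T → Step8_LayerCake G T u → strainSupIntegral T u < ⊤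

/-- **«Mini-BKM»** (p.5 l.6–7; p.1 l.7–8, l.19–20): «From ∂ₜ|ω| ≤ ‖S‖_∞|ω| + νΔ|ω|, Grönwall
excludes finite-time blow-up; smoothness and uniqueness propagate globally» — the bridge from the
a-priori bound to global regularity (deformation-tensor form of Beale–Kato–Majda + periodic local
theory; TRUE-type classically, flagged, not discharged here). [cite: Passolungo2025, §13 p.5 l.6–7] [cite: BealeKatoMajda1984, Thm 1] [claim: Passolungo2025, status: under-review] -/
def Step10_MiniBKM : Prop := ClaimedTheorem → ClaimedRegularity

/-- **THE UNPRINTED EXISTENTIAL** («extracted from u by fixed thresholds, dyadic blocks and cap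
decompositions; no randomness and no extra physics», p.4 l.25–26): for every smooth periodic
solution on `[0,T)` there are gadgets obeying the laws of §§7–12 / Boxes A–C and the layer-cake
§13 for that solution. This is where the text's devices would have to be constructed; typed as
one Prop so the chain composes. [cite: Passolungo2025, §12 p.4 l.23–28; §§7–13 p.4–5] [claim: Passolungo2025, status: under-review] -/
def GadgetsExist : Prop :=
  ∀ ν : ℝ, 0 < ν → ∀ u₀ : E3 → E3, IsDatum u₀ → ∀ T : ℝ, 0 < T →
    ∀ (u : ℝ → E3 → E3) (p : ℝ → E3 → ℝ), IsSmoothSolutionOn (Ico 0 T) ν u₀ u p →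
      ∃ G : Gadgets, Step1_Capacity G T ∧ Step1b_Interface G ∧ Step1c_Concurrency G T ∧
        Step2_BlockEnergy G ∧ Step2b_EnergeticQuantum G ∧ Step3_WeakIsotropy G ∧
        Step5_CurveGIL G ∧ Step6_StrengthenedQuantum G ∧ Step7_CarlesonMass G T ∧
        Step8_LayerCake G T u

/-! ## Compositions (PROVED; propositional) -/

/-- **COMPOSITION (PROVED)** — the printed route §4 p.2 l.5–8 / §13 p.5: gadgets for the solution
(`GadgetsExist`, carrying §§7–12 and the layer-cake) and the closing inference `Step9_Integration`
give the Main Theorem (a-priori reading). Only `Step7` and `Step8` are consumed by `Step9`; the other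
laws enter the text's derivation OF `Step7` (§12 «by strengthened quantum and concurrency»), which is
inside `GadgetsExist` at this grain. [cite: Passolungo2025, §4 p.2 l.5–8; §13 p.5 l.3–5] -/
theorem claim_of_steps (hG : GadgetsExist) (h9 : Step9_Integration) : ClaimedTheorem := by
  intro ν hν u₀ hd T hT u p hsol
  obtain ⟨G, -, -, -, -, -, -, -, -, h7, h8⟩ := hG ν hν u₀ hd T hT u p hsol
  exact h9 G T u hT h7 h8

/-- **COMPOSITION to the regularity clause (PROVED)**: with «Mini-BKM» the chain reaches «no
finite-time blow-up» (p.1 l.19–20). [cite: Passolungo2025, §2 p.1 l.19–20; §13 p.5 l.6–7] -/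
theorem regularity_of_steps (hG : GadgetsExist) (h9 : Step9_Integration) (h10 : Step10_MiniBKM) :
    ClaimedRegularity :=
  h10 (claim_of_steps hG h9)

/-- **COMPOSITION to Clay (B) (PROVED modulo the named bridge)**. [cite: Passolungo2025, §2 p.1 l.15–20] [cite: FeffermanClay2006, (B) p.2] -/
theorem clay_of_steps (hG : GadgetsExist) (h9 : Step9_Integration) (h10 : Step10_MiniBKM)
    (hB : ClayBridge) : clayPeriodic.Regularity :=
  hB (regularity_of_steps hG h9 h10)

/-- The a-priori reading implies the literal (closed-slab) reading: a classical solution on `[0,T]`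
restricts to one on `[0,T)`. [cite: Passolungo2025, §2 p.1 l.15–18] -/
theorem claimedTheoremClosed_of_claimedTheorem (h : ClaimedTheorem) : ClaimedTheoremClosed := by
  intro ν hν u₀ hd T hT u p hsol
  exact h ν hν u₀ hd T hT u p
    ⟨hsol.solves.mono Ico_subset_Icc_self (uniqueDiffOn_Ico 0 T), hsol.initial,
      fun t ht => hsol.periodic t (Ico_subset_Icc_self ht)⟩

/-! ## Rev 2 (append-only): the LITERAL reading of the Main Theorem is a theorem by compactness

«Let u be the corresponding smooth solution … on [0,T]. Then ∫₀ᵀ ‖S(t)‖_{L^∞} dt < ∞» (p.1 l.16–18)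
read with the CLOSED slab `[0,T]` holds for every smooth `ℤ³`-periodic field on `[0,T] × ℝ³`, with no
Navier–Stokes content: `∇u` is continuous on `[0,T] × ℝ³` (`IsSmoothSpaceTimeOn.continuousOn_fderiv_slice`),
hence bounded on the compact `[0,T] × [0,1]³`, hence everywhere by periodicity of `∇u(t,·)`
(`Torus.lift_descend_holds`), and `‖S‖ ≤ ‖∇u‖`. One import added (`FlatTorusProofs`). The a-priori
face `ClaimedTheorem` (`Ico 0 T`) is untouched and stays the on-path object. -/

/-- `‖S(x)‖ ≤ ‖∇v(x)‖` (the adjoint is an isometry; same computation as the private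
`PaiLimsuwan2026.norm_strain_le`). [folklore] -/
private theorem norm_strain_le (v : E3 → E3) (x : E3) : ‖strain v x‖ ≤ ‖fderiv ℝ v x‖ := by
  unfold strain
  calc ‖(1 / 2 : ℝ) • (fderiv ℝ v x + ContinuousLinearMap.adjoint (fderiv ℝ v x))‖
      ≤ ‖(1 / 2 : ℝ)‖ * (‖fderiv ℝ v x‖ + ‖ContinuousLinearMap.adjoint (fderiv ℝ v x)‖) := by
        rw [norm_smul]; exact mul_le_mul_of_nonneg_left (norm_add_le _ _) (norm_nonneg _)
    _ = ‖fderiv ℝ v x‖ := by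
        rw [LinearIsometryEquiv.norm_map, Real.norm_eq_abs, abs_of_pos (by norm_num)]; ring

/-- The derivative of a `ℤ³`-periodic field is `ℤ³`-periodic. [folklore] -/
private theorem isLatticePeriodic_fderiv {v : E3 → E3} (hv : IsLatticePeriodic v) :
    IsLatticePeriodic (fderiv ℝ v) := by
  intro j x
  rw [← fderiv_comp_add_right (EuclideanSpace.single j 1)]
  exact congrArg (fun g => fderiv ℝ g x) (funext (hv j))

/-- The closed unit cube of `ℝ³` is compact. [folklore] -/
private theorem isCompact_closedCube : IsCompact {y : E3 | ∀ i, y i ∈ Icc (0 : ℝ) 1} := by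
  refine Metric.isCompact_of_isClosed_isBounded ?_ ?_
  · have : {y : E3 | ∀ i, y i ∈ Icc (0 : ℝ) 1} = ⋂ i, (fun y : E3 => y i) ⁻¹' Icc 0 1 := by
      ext y; simp
    rw [this]
    exact isClosed_iInter fun i => isClosed_Icc.preimage (by fun_prop)
  · refine isBounded_iff_forall_norm_le.2 ⟨2, fun y hy => ?_⟩
    rw [EuclideanSpace.norm_eq]
    have h : ∑ i, ‖y i‖ ^ 2 ≤ 3 := by
      calc ∑ i, ‖y i‖ ^ 2 ≤ ∑ _i : Fin 3, (1 : ℝ) := Finset.sum_le_sum fun i _ => by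
              have hi := hy i
              rw [Real.norm_eq_abs, sq_abs]
              nlinarith [hi.1, hi.2]
        _ = 3 := by simp
    calc Real.sqrt (∑ i, ‖y i‖ ^ 2) ≤ Real.sqrt 4 := Real.sqrt_le_sqrt (by linarith)
      _ = 2 := by rw [show (4 : ℝ) = 2 ^ 2 by norm_num, Real.sqrt_sq (by norm_num)]

/-- **The literal Main Theorem (closed slab) HOLDS — PROVED, no Navier–Stokes content** (p.1
l.15–18 read with «on [0,T]» closed): for a classical `ℤ³`-periodic solution on `[0,T] × ℝ³` the
strain is bounded on `[0,T] × ℝ³` (continuity on the compact `[0,T] × [0,1]³` + periodicity), so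
`∫₀ᵀ ‖S‖_∞ < ∞`. Records-grade: it says the printed sentence is automatic in the closed-slab
reading; the a-priori reading `ClaimedTheorem` is the object on the composition path.
[cite: Passolungo2025, §2 p.1 l.15–18] -/
theorem claimedTheoremClosed_holds : ClaimedTheoremClosed := by
  intro ν hν u₀ hd T hT u p hsol
  have hcont : ContinuousOn (fun z : ℝ × E3 => fderiv ℝ (u z.1) z.2) (Icc 0 T ×ˢ univ) :=
    hsol.solves.smooth_velocity.continuousOn_fderiv_slice (uniqueDiffOn_Icc hT)
  obtain ⟨B, hB⟩ := (isCompact_Icc.prod isCompact_closedCube).exists_bound_of_continuousOn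
    (hcont.mono (prod_mono Subset.rfl (subset_univ _)))
  have hbound : ∀ t ∈ Icc 0 T, ∀ y : E3, ‖fderiv ℝ (u t) y‖ ≤ B := by
    intro t ht y
    have hP := isLatticePeriodic_fderiv (hsol.periodic t ht)
    have hy : fderiv ℝ (u t) y = fderiv ℝ (u t) (Torus.repr (Torus.proj y)) := by
      have h := congrFun (Torus.lift_descend_holds (fderiv ℝ (u t)) hP) y
      rw [Torus.lift_apply, Torus.descend_apply] at h
      exact h.symm
    rw [hy]
    exact hB (t, Torus.repr (Torus.proj y))
      ⟨ht, fun i => Ico_subset_Icc_self (Torus.repr_apply_mem_Ico _ i)⟩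
  have hsup : ∀ t ∈ Ioo 0 T, (⨆ x : E3, ‖strain (u t) x‖ₑ) ≤ ENNReal.ofReal B := by
    intro t ht
    refine iSup_le fun x => ?_
    rw [← ofReal_norm]
    exact ENNReal.ofReal_le_ofReal ((norm_strain_le (u t) x).trans (hbound t ⟨ht.1.le, ht.2.le⟩ x))
  unfold strainSupIntegral
  calc (∫⁻ t in Ioo 0 T, ⨆ x : E3, ‖strain (u t) x‖ₑ) ≤ ∫⁻ _ in Ioo 0 T, ENNReal.ofReal B :=
        setLIntegral_mono measurable_const hsup
    _ < ⊤ := by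
        rw [setLIntegral_const, Real.volume_Ioo]
        exact ENNReal.mul_lt_top ENNReal.ofReal_lt_top ENNReal.ofReal_lt_top

/-! ## Discharge of the Clay bridge `ClayBridge` (appended 2026-08-27, ns-claims-lit-4 g7, CLAY-LINK keeper)

Galilean removal of the mean (Majda–Bertozzi 2002 §1.2; the tree's
`IsClassicalNSSolutionOn.galileanBoost_const`): a Clay periodic datum `u₀` (smooth, divergence free,
`ℤ³`-periodic, ANY mean) has mean `m = ∫_{[0,1)³} u₀`; the datum `u₀ − m` is admissible in the text's
sense (`IsDatum`: mean zero); a Clay-sense solution `(v, q)` from `u₀ − m` boosted by `−m`,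
`u(t, x) = v(t, x − t m) + m`, `p(t, x) = q(t, x − t m)`, is smooth on the closed half-space, solves
(1)–(3) with datum `u₀`, and has `ℤ³`-periodic velocity slices (Fefferman's (10); the pressure is
unconstrained in `clayPeriodic`). Hence `ClaimedRegularity → clayPeriodic.Regularity`. -/

/-- The period cell is the tree's fundamental cube `[0,1)³`. [folklore] -/
private theorem cell_eq_unitCube : cell = FunctionSpaces.Torus.unitCube (Fin 3) := rfl

/-- Subtracting the cell mean of a continuous field gives a mean-zero field (`vol [0,1)³ = 1`).
[folklore] -/
private theorem isMeanZero_sub_setIntegral {v : E3 → E3} (hv : Continuous v) :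
    IsMeanZero (fun x => v x - ∫ y in cell, v y) := by
  unfold IsMeanZero
  have hi : IntegrableOn v cell volume := by
    rw [cell_eq_unitCube]; exact FunctionSpaces.Torus.integrableOn_unitCube_of_continuous hv
  have hvol : volume cell = 1 := by
    rw [cell_eq_unitCube]; exact FunctionSpaces.Torus.volume_unitCube
  have hc : IntegrableOn (fun _ : E3 => ∫ y in cell, v y) cell volume :=
    integrableOn_const (by rw [hvol]; exact ENNReal.one_ne_top)
  rw [integral_sub hi hc, setIntegral_const]
  simp [Measure.real, hvol]

/-- The mean-removed datum is admissible in the text's sense. [folklore] -/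
private theorem isDatum_sub_mean {u₀ : E3 → E3} (hs : ContDiff ℝ ∞ u₀) (hd : NSWave0.IsDivFree u₀)
    (hper : IsLatticePeriodic u₀) : IsDatum (fun x => u₀ x - ∫ y in cell, u₀ y) where
  smooth := hs.sub contDiff_const
  periodic := fun j x => by simp only [hper j x]
  meanZero := isMeanZero_sub_setIntegral hs.continuous
  divFree := fun x => by
    unfold NSWave0.divergence
    rw [fderiv_sub_const]
    exact hd x

/-- **The Clay bridge holds**: (B) on mean-zero data ⇒ (B), by Galilean removal of the mean.
[cite: MajdaBertozzi2002, §1.2 (Galilean invariance)] [cite: FeffermanClay2006, (B) with (8) (10) (11) p.2] -/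
theorem clayBridge_holds : ClayBridge := by
  intro hreg ν hν u₀ hu₀ hdiv hper
  set m : E3 := ∫ y in cell, u₀ y with hm_def
  obtain ⟨v, q, hv, hq, hns, hvper⟩ := hreg ν hν _ (isDatum_sub_mean hu₀ hdiv hper)
  have hcl : IsClassicalNSSolutionOn (Ici 0) ν 0 v q :=
    (isNavierStokesSolution_and_smooth_iff.1 ⟨hns, hv, hq⟩).1
  have hv0 : v 0 = fun x => u₀ x - m := (isNavierStokesSolution_and_smooth_iff.1 ⟨hns, hv, hq⟩).2
  -- boost by `−m`
  have hb : IsClassicalNSSolutionOn (Ici 0) ν 0 (fun t y => v t (y + t • (-m)) - (-m))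
      (fun t y => q t (y + t • (-m))) :=
    hcl.galileanBoost_const (uniqueDiffOn_Ici 0) (-m)
  have h0 : (fun y => v 0 (y + (0 : ℝ) • (-m)) - (-m)) = u₀ := by
    funext y
    simp [hv0]
  obtain ⟨hns', hU, hP⟩ :=
    (isNavierStokesSolution_and_smooth_iff (ν := ν) (f := 0) (u₀ := u₀)
      (u := fun t y => v t (y + t • (-m)) - (-m)) (p := fun t y => q t (y + t • (-m)))).2 ⟨hb, h0⟩
  refine ⟨_, _, hU, hP, hns', fun t ht j y => ?_⟩
  show v t (y + EuclideanSpace.single j 1 + t • (-m)) - (-m) = v t (y + t • (-m)) - (-m)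
  rw [add_right_comm, hvper t ht j (y + t • (-m))]

/-- **COMPOSITION to Clay (B), bridge discharged**: the chain now composes to (B) modulo the text's
Steps and the TRUE-type continuation `Step10_MiniBKM` only. [cite: Passolungo2025, §2 p.1 l.15–20]
[cite: FeffermanClay2006, (B) p.2] -/
theorem clay_of_steps' (hG : GadgetsExist) (h9 : Step9_Integration) (h10 : Step10_MiniBKM) :
    clayPeriodic.Regularity :=
  clay_of_steps hG h9 h10 clayBridge_holds

/-- **Clay (B) from the text's regularity conclusion on mean-zero data** (no Step hypotheses).
[cite: Passolungo2025, §2 p.1 l.15–20] [cite: FeffermanClay2006, (B) p.2] -/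
theorem clay_of_claimedRegularity (h : ClaimedRegularity) : clayPeriodic.Regularity :=
  clayBridge_holds h

/-! ## Appendix (ns-claims-lit-3 g8, D-0026 / claim-file completeness): Step 10 «mini-BKM» discharged

The TRUE-type continuation `Step10_MiniBKM : ClaimedTheorem → ClaimedRegularity` (p.5 l.6–7 «From
∂ₜ|ω| ≤ ‖S‖_∞|ω| + νΔ|ω|, Grönwall excludes finite-time blow-up; smoothness and uniqueness propagate
globally»; p.1 l.19–20) is PROVED here, Literature-side, from the support file
`Literature/Claims/NS/ClayPeriodicStrainSupCriterion.lean` (`ClayVariants.clayPeriodic_solvable_of_aprioriStrainSup`: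
the periodic blow-up alternative, enstrophy branch, against the strain-form enstrophy Grönwall bound
`Torus.torusEnstrophy_le_mul_exp_integral_strainBound`). Summits-side twin (landed first, same
statement): `Summit.NavierStokesRegularity.NavierStokesRegularity.Theorems.Passolungo2025Salvage.step10_holds`
(`Theorems/SoloSalvagePassolungo2025MiniBKM.lean`, seat `ns-claims-salvage-p3` g4). Nothing above this
block is changed; no Step is asserted. -/

/-- **Step 10 «mini-BKM» holds**: an a priori bound `∫₀ᵀ sup‖S‖ < ∞` along every periodic classical
solution on every `[0,T)` from an admissible (smooth, periodic, mean-zero, divergence-free) datum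
gives a global smooth periodic solution, i.e. `clayPeriodic.Solvable ν 0 u₀` — Beale–Kato–Majda in
deformation-tensor form on `𝕋³`, via `ClayVariants.clayPeriodic_solvable_of_aprioriStrainSup`; for
`T ≤ 0` the integral is over the empty interval. Twin:
`Summit.NavierStokesRegularity.NavierStokesRegularity.Theorems.Passolungo2025Salvage.step10_holds`.
[cite: Passolungo2025, §13 p.5 l.6–7; §2 p.1 l.19–20] [cite: BealeKatoMajda1984, Thm 1 (mechanism, strain form)]
[cite: FeffermanClay2006, (B) with (8) (10) (11) p.2] -/
theorem step10_MiniBKM_holds : Step10_MiniBKM := by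
  intro hC ν hν u₀ hu₀
  refine clayPeriodic_solvable_of_aprioriStrainSup hν hu₀.smooth hu₀.divFree hu₀.periodic ?_
  intro T u p hcl hu0 hperT
  rcases le_or_gt T 0 with hT | hT
  · simp [Ioo_eq_empty_of_le hT]
  · exact hC ν hν u₀ hu₀ T hT u p ⟨hcl, hu0, fun t ht => (hperT t ht).1⟩

/-- **COMPOSITION to Clay (B) modulo the text's own Steps only** (`GadgetsExist`, `Step9_Integration`):
both classical links — the mean-zero bridge `clayBridge_holds` and the mini-BKM continuation
`step10_MiniBKM_holds` — are now discharged in this file. [cite: Passolungo2025, §2 p.1 l.15–20]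
[cite: FeffermanClay2006, (B) p.2] -/
theorem clay_of_steps'' (hG : GadgetsExist) (h9 : Step9_Integration) : clayPeriodic.Regularity :=
  clay_of_steps' hG h9 step10_MiniBKM_holds

/-! ## TRUE column (D-0026 debt, append-only; ns-claims-typist-6 g7): the unprinted existential
`GadgetsExist` HOLDS — with no meaning attached to the signature, the laws of §§7–12 / Boxes A–C and the
layer-cake §13 are obeyed, for EVERY field `u` on every slab, by gadgets whose printed constants are all
`0` (`σ = 1/8`), `μ ≡ 0`, `E₀ = C_μ = C_lc = 1`, `a_k(t) := sup_x |S(u(t))(x)|` and all levels active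
(`θ_m = 1`, `A_{r,m} = ℝ`, level sum `∞`). Kernel face of the records note «symbols used but never defined
in the text»: the typed chain constrains nothing before §13's one-clause inference `Step9_Integration`
(the other binder of `claim_of_steps`). -/

/-- The trivial gadgets attached to a field `u` (every law of §§7–12 holds with zero constants; the
layer-cake §13 holds with `a_k(t) = ‖S(t)‖_∞`, `C_lc = 1` and an infinite level sum). [folklore] -/
private def trivialGadgets (u : ℝ → E3 → E3) : Gadgets where
  E₀ := 1
  fluxPlus := fun _ _ => 0
  influx := fun _ _ => 0
  NN := fun _ _ => 0
  EB := fun _ _ => 0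
  K := fun _ => 0
  cν := 0
  Cloc := 0
  ce := 0
  cstar := 0
  Cwi := 0
  cgil := 0
  σ := 1 / 8
  δ := fun _ => 0
  qener := fun _ _ => 0
  q := fun _ _ => 0
  gil := fun _ => 0
  a := fun _ t => ⨆ x : E3, ‖strain (u t) x‖ₑ
  J := 0
  L := 1
  θlev := fun _ => 1
  A := fun _ _ => univ
  μ := fun _ => 0
  Cμ := 1
  Clc := 1

/-- **`GadgetsExist` HOLDS (PROVED)**: for every `ν`, datum, slab and smooth periodic solution (indeed for
every field `u` whatsoever) the trivial gadgets obey `Step1_Capacity`, `Step1b_Interface`,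
`Step1c_Concurrency`, `Step2_BlockEnergy`, `Step2b_EnergeticQuantum`, `Step3_WeakIsotropy`,
`Step5_CurveGIL`, `Step6_StrengthenedQuantum`, `Step7_CarlesonMass` and `Step8_LayerCake` — the typed
laws over the uninterpreted signature carry no constraint linking them to the solution.
[cite: Passolungo2025, §12 p.4 l.23–28; §§7–13 p.4–5] -/
theorem gadgetsExist_holds : GadgetsExist := by
  intro ν _ u₀ _ T _ u p _
  refine ⟨trivialGadgets u, ?_, ?_, ?_, ?_, ?_, ?_, ?_, ?_, ?_, ?_⟩
  · intro j a b _ _ _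
    simp [trivialGadgets]
  · intro r j t
    simp [trivialGadgets]
  · intro r a b _ _ _
    simp [trivialGadgets]
  · intro r t
    simp [trivialGadgets]
  · intro r θ _
    simp [trivialGadgets]
  · refine ⟨by norm_num [trivialGadgets], by norm_num [trivialGadgets], fun θ _ => ?_⟩
    simp [trivialGadgets]
  · intro θ _
    simp [trivialGadgets]
  · intro r θ _
    simp [trivialGadgets]
  · intro a b _ _ _
    simp [trivialGadgets]
  · refine ⟨fun t _ => ?_, fun r t _ => ?_⟩
    · dsimp only [trivialGadgets]
      refine le_trans ?_ (le_of_eq (one_mul _).symm)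
      refine le_trans (le_of_eq ?_) (ENNReal.le_tsum 0)
      simp
    · dsimp only [trivialGadgets]
      have htop : (∑' _ : ℕ, (1 : ℝ≥0∞) * (univ : Set ℝ).indicator 1 t) = ⊤ := by simp
      rw [htop, ENNReal.mul_top (by positivity)]
      exact le_top

end

end Literature.Claims.NS.Passolungo2025
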